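import Literature.MathematicalPhysics.QuantumFieldTheory.Balaban1983to89.B9B8KnitLetterQpDiff
import Literature.MathematicalPhysics.QuantumFieldTheory.Balaban1983to89.B9B8KnitLetterMajorantTransfer
import Literature.MathematicalPhysics.QuantumFieldTheory.Balaban1983to89.B9Thm39CinvUpperL
import Literature.MathematicalPhysics.QuantumFieldTheory.Balaban1983to89.B9Cor35GpCubeInputsAtOne

/-!
# `Balaban1983to89.B9B8KnitLetterXDiffMajorant` — THE LETTER `X = Q′G′²Q′*` OF [B9] (3.25)∕(3.95) AT def-Y's LETTER OF RECORD AND AT PRINT's KNIT LETTER: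
# `η⁴·(X(U; parSymY) − X(U; parKnitY))` has a (2.83)-shape block majorant `θ_F·ℓ(a)⁴·e^{−δ″d(a,a′)}` with `θ_F = O(α₀′)`, from the (3.42)₁ majorants of `η²G′` at
# the two letters, the block-diagonal majorant of `η⁻²(Δ′_sym − Δ′_knit)` (file 9 §1) and file 23a's `Q′`-differences — the second ingredient of the C-line
# sym→knit transfer (junction J-B file 23b, seat p33; consumer: file 23c's resolvent expansion of `X_knit⁻¹` around `X_sym⁻¹`)

statement-level skeleton of published theorems with citation tags; proofs where landed; nothing here is a claim about the
Yang–Mills mass gap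

T. Bałaban, *Propagators for lattice gauge theories in a background field*, Commun. Math. Phys. **99** (1985) 389–434 [`Balaban1985BackgroundPropagators`,
"[B9]"]; T. Bałaban, *Propagators and renormalization transformations for lattice gauge theories. II*, Commun. Math. Phys. **96** (1984) 223–250
[`Balaban1984PropagatorsII`, "[4]"]; T. Bałaban, *Averaging operations for lattice gauge theories*, Commun. Math. Phys. **98** (1985) 17–51
[`Balaban1985Averaging`, "[B7]"].

THE PRINT.  [B9] (3.25) p. 395 (`Q′G′²Q′*` inside `R`), Thm 3.2 (3.48) p. 398, (3.95) p. 411 («By the same estimates as in [4], especially (2.83)–(2.85), we can see that the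
operator R is small»), (3.19) p. 393 (the knit letter «(52), (53) in [5]»), (3.90) pp. 409–410 (resolvent expansions «convergent in all norms»); [4] (2.50)–(2.52)
p. 232, (2.83) p. 237 («O(1)(Lʲη)⁴e^{−½δ₀d(y,y″)}» — the shape of `Q′G′²Q′*`), Lemma 2.1 (2.60)–(2.61) p. 234; [B7] (52)–(53) pp. 26–27.

WHY THIS FILE ∕ THE ARGUMENT.  File 23c expands `X_knit⁻¹ = X_sym⁻¹ + X_knit⁻¹·(X_sym − X_knit)·X_sym⁻¹`; its small letter is `F := η⁴(X_sym − X_knit)`.  With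
`a := η²G′(U; parSymY)`, `c := η²G′(U; parKnitY)`, `Q′_s, Q′_k` ∕ `Q′_s*, Q′_k*` the block averages ∕ extensions at the two tables:
`F = (Q′_s − Q′_k)·a²·Q′_s* + Q′_k·(a² − c²)·Q′_s* + Q′_k·c²·(Q′_s* − Q′_k*)` and `a² − c² = −[a(c − a) + (c − a)c]`, `c − a = c·(η⁻²E)·a` (file 9's realified
resolvent identity, `E = Δ′_sym − Δ′_knit`).  Every factor has a majorant in [4]'s (2.51) currency: `a, c ≺ A·ℓ²·e^{−δd}` ((3.42)₁ at the two letters — M5.5 ∕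
FILE 9 and file 9), `η⁻²E ≺ θ_E·𝟙` (file 9 §1, `θ_E = 32(d+1)²α₀′M₂Σ‖b‖` in print's units), `Q′, Q′* ≺ κ·𝟙` (p21's sandwich file, `κ = M₂Σ‖b‖`),
`Q′_s − Q′_k, Q′_s* − Q′_k* ≺ κ_Δ·𝟙` (file 23a, `κ_Δ = 16(d+1)²α₀′M₂Σ‖b‖`); products of two `ℓ²`-weighted letters are `ℓ⁴`-weighted ((2.83), p21's
`hasMajorant_mul_weighted` with the scale transfer of `ℓ²` and Lemma 2.1), and `ℓ² ≤ 1` in print's units lets the triple product `c·(η⁻²E)·a` be read as an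
`ℓ²`-weighted letter again.  Two product levels cost the rate twice: `δ′ = (1−α′)(1−α_st)δ`, `δ″ = (1−α′)(1−α_st)δ′`.

CITATION HEADER (lean-in-tree rule).  Cell `lit-balaban`, sub-row G-B9-LETTERS, junction J-B file 23b → seat `lit-balaban-p33` gen 98.  REUSED BY NAME: p21's
`B9Thm39CinvUpperL.hasMajorant_mul_weighted`, `B9Thm39CinvSandwichQ.{hasMajorant_conj_sandwich, hasMajorantHom_conjHom_QpY, hasMajorantHom_conjHom_QpsY,
smul_XY_restrictScalars}`, p33 J-B 9 `B9B8KnitLetterMajorantTransfer.{conj_fixedPoint, sum_ite_eq_mul, geo9K_len_sq_le_one}`, J-B 23a `B9B8KnitLetterQpDiff.*`,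
r03∕p21 `B6RandomWalk.{hasMajorant_mul, hasMajorant_mono, hasMajorant_add}`, p33 `B9Cor35GpCubeInputsAtOne.hasMajorant_neg`, `B9Eq352DivFormLetters.{conj, conj_mul, conj_sub, conj_neg}`.

WHAT THIS FILE PROVES (sorry-free; no definitions; the (3.42)₁ majorants at the two letters and the diagonal majorant of `η⁻²E` are DISPLAYED hypotheses).
* §1 `rate_le` (`(1−α′)(1−α_st)δ ≤ δ`), `hasMajorant_rate_mono` (weakening the rate of an `A·w·e^{−δd}` majorant), ★ `hasMajorant_conj_GpDiff` — the letter
  `η²(G′_knit − G′_sym)` has the majorant `A_kθ_EA_sL²c₁·ℓ(a)²·e^{−δ′d}` (triple product + `ℓ² ≤ 1`).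
* §2 ★ `hasMajorant_conj_sq` (`η⁴G′²` at either letter: `A²L²c₁·ℓ⁴·e^{−δ′d}`, = p21 F3a at the member), ★ `hasMajorant_conj_sqDiff` (`η⁴(G′_s² − G′_k²) ≺ (A_s+A_k)θ_DL²c₁′·ℓ⁴·e^{−δ″d}`).
* §3 `smul_XY_sub_eq` (the three-term identity for `η⁴(X_s − X_k)`), ★★★ **`hasMajorant_conj_XY_sym_sub_knit`** — on def-Y's block carrier `(s, j) ↦ ιB s`:
  `conj b(η⁴·(X(U; parSymY) − X(U; parKnitY))) ≺ θ_F·ℓ(a)⁴·e^{−δ″d}`, `θ_F = κ_Δκ·A_s²L²c₁ + κ²·(A_s+A_k)θ_DL²c₁′ + κκ_Δ·A_k²L²c₁` — every summand carries a factor `α₀′`.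

HONEST SCOPE.  Composition of landed majorant calculus; the (3.42)₁ site majorants of `η²G′` at BOTH letters (suppliers: FILE 9 ∕ M5.5 at `parSymY`, file 9 at
`parKnitY`), the diagonal majorant of `η⁻²E` (file 9 §1), the transporters' contractivity and closeness (file 23a's hypotheses: `G ≤ U(N)` averaging-closed, class
(52)), the geometry ((2.54), `d ≥ 0`, scale transfer of `ℓ²` and (2.61) at two rate levels) and print's units `c_f = L^k` are DISPLAYED; the rate degrades by
`(1−α′)²(1−α_st)²` («a decay rate arbitrarily close»); constants explicit, unoptimised.  Nothing of Theorems 3.1∕3.2 is asserted; count-neutral; nothing continuum,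
nothing about OS axioms or the mass gap.  No `sorry`, no `axiom`, no `… : Prop` fact, no `instance`, no `notation`, no `def`.  NEW file; nothing landed is
modified.  Net new unproved facts: 0.  Seat `lit-balaban-p33` gen 98, 2026-08-28.  RELATED, NOT DUPLICATED (searched 2026-08-28: `lean search
'XDiff|XY_sym_sub_knit|conj_GpDiff|conj_sqDiff' --decl` = ∅): file 9 (the `G′` transfer; its identity reused), p21's F3a∕F3b (the `η⁴G′²` ∕ sandwich devices, reused).
-/

noncomputable section

namespace Literature.MathematicalPhysics.QuantumFieldTheory.Balaban1983to89.B9B8KnitLetterXDiffMajorant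

open Node00
open B6Geom246MultiLevelBox (blkOf)
open B6KLevelCensusIndexV1 (KIdx)
open B6RandomWalk (HasMajorant Triangle254 Ineq261 hasMajorant_mono hasMajorant_mul hasMajorant_add c1_nonneg)
open B6RandomWalkHom (HasMajorantHom)
open B9Thm34Ext (toB6)
open B9GeoNormsKLevelV1 (geo9K)
open B9GeoLemma21KLevelV1 (geo9K_dist_nonneg')
open B9Ineq347 (ScaleTransfer)
open B9Eq352DivFormLetters (conj conj_mul conj_sub conj_neg)
open B9Eq352GradLetters (conj_add)
open B9Eq376POneLetters (conjHom)
open B9Thm39CinvUpperL (hasMajorant_mul_weighted)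
open B9Cor35GpCubeInputsAtOne (hasMajorant_neg)
open B9Thm39CinvSandwichQ (hasMajorant_conj_sandwich hasMajorantHom_conjHom_QpY hasMajorantHom_conjHom_QpsY smul_XY_restrictScalars)
open B9B8KnitLetterMajorantTransfer (conj_fixedPoint sum_ite_eq_mul geo9K_len_sq_le_one)
open B9B8KnitLetterQpDiff (hasMajorantHom_conjHom_QpY_sym_sub_knit hasMajorantHom_conjHom_QpsY_sym_sub_knit qpT_parSymY_bicontractive qpT_parKnitY_bicontractive)
open B7Prop2Explicit (AvgClosed pdev C0 c2' unitaryUnits)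
open B9B8CarrierDictionary (liftCfg)
open B9B8AveragingJunction (parKnitY)
open B9B8KnitLetterRegular (parKnitY_mem_of_pdev)
open scoped Matrix Matrix.Norms.L2Operator

variable {d ℓ : ℕ} {hd : 1 ≤ d + 1} {hL : Odd (ℓ + 1) ∧ 1 < ℓ + 1} {b₀ b₁ : ℝ}
variable (i : KIdx d ℓ hd hL b₀ b₁) {N : ℕ} {G : Subgroup (Matrix (Fin N) (Fin N) ℂ)ˣ}
variable {ι : Type} [Fintype ι] (b : Module.Basis ι ℝ (Matrix (Fin N) (Fin N) ℂ))
variable [Fintype (geo9K i).Site] [DecidableEq (geo9K i).Site] {Rr : ℝ} {Hp : Prop} (ιB : BlkY i → IBondY i)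

/-! ## §1 Rates, and the letter `η²(G′_knit − G′_sym)` -/

omit [Fintype ι] [Fintype (geo9K i).Site] [DecidableEq (geo9K i).Site] in
/-- the degraded rate `(1−α′)(1−α_st)δ` is at most `δ` (`0 ≤ α′ ≤ 1`, `α_stδ ≥ 0`, `(1−α_st)δ ≥ 0`). [cite: Balaban1984PropagatorsII, (2.66) p.234, bookkeeping] -/
theorem rate_le {δ αst α' : ℝ} (hαδ : 0 ≤ αst * δ) (hα'0 : 0 ≤ α') (hδ' : 0 ≤ (1 - αst) * δ) : (1 - α') * ((1 - αst) * δ) ≤ δ := by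
  nlinarith

omit [Fintype ι] [DecidableEq (geo9K i).Site] in
/-- weakening the rate of a weighted exponential majorant on the member's geometry (`d ≥ 0`, `A·w ≥ 0`).
[cite: Balaban1984PropagatorsII, (2.51) p.232, bookkeeping] -/
theorem hasMajorant_rate_mono {X : Type} (blk : X → (geo9K i).Site) {T : Module.End ℝ (X → ℝ)} {A δ δ₁ : ℝ} (w : (geo9K i).Site → ℝ) (hA : 0 ≤ A)
    (hw : ∀ a, 0 ≤ w a) (hδ : δ₁ ≤ δ)
    (h : HasMajorant (g := toB6 (geo9K i) Rr Hp) blk T (fun a a' => A * w a * Real.exp (-(δ * (geo9K i).dist a a')))) :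
    HasMajorant (g := toB6 (geo9K i) Rr Hp) blk T (fun a a' => A * w a * Real.exp (-(δ₁ * (geo9K i).dist a a'))) :=
  hasMajorant_mono _ h fun a a' => mul_le_mul_of_nonneg_left
    (Real.exp_le_exp.2 (by nlinarith [geo9K_dist_nonneg' i a a', mul_le_mul_of_nonneg_right hδ (geo9K_dist_nonneg' i a a')]))
    (mul_nonneg hA (hw a))

/-- ★ **THE LETTER `η²(G′(U; parKnitY) − G′(U; parSymY))` HAS THE MAJORANT `A_kθ_EA_sL²c₁·ℓ(a)²·e^{−δ′d}`** (file 9's realified resolvent identity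
`conj(η²G′_k) − conj(η²G′_s) = conj(η²G′_k)·conj(η⁻²E)·conj(η²G′_s)`; the diagonal majorant of `η⁻²E` keeps the weight `ℓ²` of `G′_s` at its point (no (2.61)), then ONE
weighted product with `G′_k`, then `ℓ⁴ ≤ ℓ²` in print's units).  Displayed: the two (3.42)₁ majorants, the diagonal majorant `θ_E·𝟙` of `η⁻²E`, the geometry.
[cite: Balaban1985BackgroundPropagators, Thm 3.1 (3.42) p.397, (3.90) pp.409–410, (3.19) p.393; Balaban1984PropagatorsII, (2.50)–(2.52) p.232, (2.60)–(2.61) p.234] -/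
theorem hasMajorant_conj_GpDiff [Nonempty (Fin N)] (hG : G ≤ unitaryUnits (Matrix (Fin N) (Fin N) ℂ))
    {U : CfgY (Matrix (Fin N) (Fin N) ℂ) i} (hU : ∀ μ x, U μ x ∈ G) (hparK : ∀ z w : SiteY i, parKnitY i U z w ∈ G)
    (hcf : i.cf = (((ℓ + 1 : ℕ) : ℝ)) ^ i.k)
    (d₁ : ℕ) {δ αst α' C As Ak θE : ℝ} (hAs : 0 ≤ As) (hAk : 0 ≤ Ak) (hθE : 0 ≤ θE) (hC : 0 ≤ C)
    (hαδ : 0 ≤ αst * δ) (hα'0 : 0 ≤ α') (hα'1 : α' ≤ 1) (hδ' : 0 ≤ (1 - αst) * δ)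
    (htri : Triangle254 (toB6 (geo9K i) Rr Hp)) (hdnn : ∀ a a' : (geo9K i).Site, 0 ≤ (geo9K i).dist a a')
    (hST : ScaleTransfer (geo9K i) δ αst C (fun a => (geo9K i).len a ^ 2))
    (h261 : Ineq261 d₁ (toB6 (geo9K i) Rr Hp) ((1 - αst) * δ) α')
    (hE : HasMajorant (g := toB6 (geo9K i) Rr Hp) (fun p : SiteY i × ι => ιB (blkOf i.D.toDomains p.1))
      (conj b ((etaS i ^ 2)⁻¹ • (deltaPrimeAY i (parSymY i) U - deltaPrimeAY i (parKnitY i) U).restrictScalars ℝ))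
      (fun a a' : (geo9K i).Site => if a = a' then θE else 0))
    (hGs : HasMajorant (g := toB6 (geo9K i) Rr Hp) (fun p : SiteY i × ι => ιB (blkOf i.D.toDomains p.1))
      (conj b ((etaS i ^ 2) • (GpY i (parSymY i) U).restrictScalars ℝ)) (fun a a' => As * (geo9K i).len a ^ 2 * Real.exp (-(δ * (geo9K i).dist a a'))))
    (hGk : HasMajorant (g := toB6 (geo9K i) Rr Hp) (fun p : SiteY i × ι => ιB (blkOf i.D.toDomains p.1))
      (conj b ((etaS i ^ 2) • (GpY i (parKnitY i) U).restrictScalars ℝ)) (fun a a' => Ak * (geo9K i).len a ^ 2 * Real.exp (-(δ * (geo9K i).dist a a')))) :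
    HasMajorant (g := toB6 (geo9K i) Rr Hp) (fun p : SiteY i × ι => ιB (blkOf i.D.toDomains p.1))
      (conj b ((etaS i ^ 2) • ((GpY i (parKnitY i) U).restrictScalars ℝ - (GpY i (parSymY i) U).restrictScalars ℝ)))
      (fun a a' => Ak * (θE * As) * C * B6.c1 d₁ ((1 - αst) * δ) α' * (geo9K i).len a ^ 2 *
        Real.exp (-((1 - α') * ((1 - αst) * δ) * (geo9K i).dist a a'))) := by
  have hl : ∀ a : (geo9K i).Site, 0 ≤ (geo9K i).len a ^ 2 := fun a => sq_nonneg _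
  -- the remainder `R′ = conj(η⁻²E)·conj(η²G′_s) ≺ θ_E·A_s·ℓ(a)²·e^{−δd}` (diagonal first factor)
  have hK₂ : ∀ a a' : (geo9K i).Site, 0 ≤ As * (geo9K i).len a ^ 2 * Real.exp (-(δ * (geo9K i).dist a a')) := fun a a' =>
    mul_nonneg (mul_nonneg hAs (hl a)) (Real.exp_nonneg _)
  have hR : HasMajorant (g := toB6 (geo9K i) Rr Hp) (fun p : SiteY i × ι => ιB (blkOf i.D.toDomains p.1))
      (conj b ((etaS i ^ 2)⁻¹ • (deltaPrimeAY i (parSymY i) U - deltaPrimeAY i (parKnitY i) U).restrictScalars ℝ)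
        * conj b ((etaS i ^ 2) • (GpY i (parSymY i) U).restrictScalars ℝ))
      (fun a a' => (θE * As) * (geo9K i).len a ^ 2 * Real.exp (-(δ * (geo9K i).dist a a'))) := by
    refine hasMajorant_mono _ (hasMajorant_mul _ hE hGs hK₂) fun a a' => ?_
    have hsum := sum_ite_eq_mul (S := (geo9K i).Site) a θE (fun y'' => As * (geo9K i).len y'' ^ 2 * Real.exp (-(δ * (geo9K i).dist y'' a')))
    refine (le_of_eq hsum).trans (le_of_eq ?_)
    ring
  -- ONE weighted product with `conj(η²G′_k)` on the left: weight `ℓ²·ℓ²`, rate `δ′`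
  have hprod := hasMajorant_mul_weighted (g := geo9K i) (R := Rr) (H := Hp) (fun p : SiteY i × ι => ιB (blkOf i.D.toDomains p.1)) d₁
    (fun a => (geo9K i).len a ^ 2) (fun a => (geo9K i).len a ^ 2) hAk (mul_nonneg hθE hAs) hC hl hl hαδ hα'0 hα'1 hδ' htri hdnn hST h261 hGk hR
  -- the operator IS `conj(η²(G′_k − G′_s))` by file 9's fixed-point identity
  have hfix := conj_fixedPoint i b hG hU hparK (B9Ineq349SiteComposite.etaS_pos i).ne'
  have hop : conj b ((etaS i ^ 2) • ((GpY i (parKnitY i) U).restrictScalars ℝ - (GpY i (parSymY i) U).restrictScalars ℝ)) =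
      conj b ((etaS i ^ 2) • (GpY i (parKnitY i) U).restrictScalars ℝ) *
        (conj b ((etaS i ^ 2)⁻¹ • (deltaPrimeAY i (parSymY i) U - deltaPrimeAY i (parKnitY i) U).restrictScalars ℝ)
          * conj b ((etaS i ^ 2) • (GpY i (parSymY i) U).restrictScalars ℝ)) := by
    rw [smul_sub, conj_sub]
    exact sub_eq_of_eq_add' hfix
  rw [hop, ← mul_assoc]
  -- `ℓ⁴ ≤ ℓ²` in print's units
  refine hasMajorant_mono _ (by rw [mul_assoc]; exact hprod) fun a a' => ?_
  have hℓ1 := geo9K_len_sq_le_one i hcf a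
  have h0 : 0 ≤ Ak * (θE * As) * C * B6.c1 d₁ ((1 - αst) * δ) α' := mul_nonneg (mul_nonneg (mul_nonneg hAk (mul_nonneg hθE hAs)) hC) (c1_nonneg _ _ _)
  have hw : (geo9K i).len a ^ 2 * (geo9K i).len a ^ 2 ≤ (geo9K i).len a ^ 2 := by nlinarith [hl a]
  exact mul_le_mul_of_nonneg_right (mul_le_mul_of_nonneg_left hw h0) (Real.exp_nonneg _)

/-! ## §2 The squares `η⁴G′²` at the two letters and their difference -/

omit [DecidableEq (geo9K i).Site] in
/-- ★ **`η⁴G′² ≺ A²L²c₁·ℓ⁴·e^{−δ′d}`** for a letter `G′` with `η²G′ ≺ A·ℓ²·e^{−δd}` ([4] (2.83) at the member; p21's F3a `hasMajorant_mul_weighted`, weights `ℓ²·ℓ²`).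
[cite: Balaban1984PropagatorsII, (2.83) p.237, (2.52) p.232, (2.60)–(2.61) p.234; Balaban1985BackgroundPropagators, (3.95) p.411] -/
theorem hasMajorant_conj_sq (Gp : Module.End ℝ (SiteY i → Matrix (Fin N) (Fin N) ℂ))
    (d₁ : ℕ) {δ αst α' C A : ℝ} (hA : 0 ≤ A) (hC : 0 ≤ C)
    (hαδ : 0 ≤ αst * δ) (hα'0 : 0 ≤ α') (hα'1 : α' ≤ 1) (hδ' : 0 ≤ (1 - αst) * δ)
    (htri : Triangle254 (toB6 (geo9K i) Rr Hp)) (hdnn : ∀ a a' : (geo9K i).Site, 0 ≤ (geo9K i).dist a a')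
    (hST : ScaleTransfer (geo9K i) δ αst C (fun a => (geo9K i).len a ^ 2))
    (h261 : Ineq261 d₁ (toB6 (geo9K i) Rr Hp) ((1 - αst) * δ) α')
    (hGp : HasMajorant (g := toB6 (geo9K i) Rr Hp) (fun p : SiteY i × ι => ιB (blkOf i.D.toDomains p.1))
      (conj b ((etaS i ^ 2) • Gp)) (fun a a' => A * (geo9K i).len a ^ 2 * Real.exp (-(δ * (geo9K i).dist a a')))) :
    HasMajorant (g := toB6 (geo9K i) Rr Hp) (fun p : SiteY i × ι => ιB (blkOf i.D.toDomains p.1))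
      (conj b ((etaS i ^ 2 * etaS i ^ 2) • (Gp * Gp)))
      (fun a a' => A * A * C * B6.c1 d₁ ((1 - αst) * δ) α' * ((geo9K i).len a ^ 2 * (geo9K i).len a ^ 2) *
        Real.exp (-((1 - α') * ((1 - αst) * δ) * (geo9K i).dist a a'))) := by
  have hl : ∀ a : (geo9K i).Site, 0 ≤ (geo9K i).len a ^ 2 := fun a => sq_nonneg _
  exact B9Thm39CinvUpperL.hasMajorant_conj_mul_weighted b (g := geo9K i) (R := Rr) (H := Hp) (fun p : SiteY i × ι => ιB (blkOf i.D.toDomains p.1)) d₁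
    (fun a => (geo9K i).len a ^ 2) (fun a => (geo9K i).len a ^ 2) (etaS i ^ 2) (etaS i ^ 2) hA hA hC hl hl hαδ hα'0 hα'1 hδ' htri hdnn hST h261 hGp hGp

omit [Fintype ι] [Fintype (geo9K i).Site] [DecidableEq (geo9K i).Site] in
/-- the algebra of the middle letter: `a² − c² = −(a(c − a) + (c − a)c)` in any ring. [cite: Balaban1984PropagatorsII, (2.50) p.232, bookkeeping] -/
theorem sq_sub_sq_eq {R₀ : Type*} [Ring R₀] (a c : R₀) : a * a - c * c = -(a * (c - a) + (c - a) * c) := by noncomm_ring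

/-- ★ **THE DIFFERENCE OF THE SQUARES `η⁴(G′_s² − G′_k²) ≺ (A_s + A_k)·θ_D·L²c₁′·ℓ⁴·e^{−δ″d}`**, `θ_D = A_kθ_EA_sL²c₁` (§1), `δ″ = (1−α′)(1−α_st)δ′`: from
`a² − c² = −(a(c − a) + (c − a)c)`, §1 for `c − a` (rate `δ′`, weight `ℓ²`), the two (3.42)₁ majorants weakened to the rate `δ′`, and two weighted products at
the second rate level (scale transfer of `ℓ²` and (2.61) at `δ′`). [cite: Balaban1985BackgroundPropagators, (3.95) p.411, (3.90) pp.409–410; Balaban1984PropagatorsII, (2.83) p.237, (2.50)–(2.52) p.232, (2.60)–(2.61) p.234] -/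
theorem hasMajorant_conj_sqDiff [Nonempty (Fin N)] (hG : G ≤ unitaryUnits (Matrix (Fin N) (Fin N) ℂ))
    {U : CfgY (Matrix (Fin N) (Fin N) ℂ) i} (hU : ∀ μ x, U μ x ∈ G) (hparK : ∀ z w : SiteY i, parKnitY i U z w ∈ G)
    (hcf : i.cf = (((ℓ + 1 : ℕ) : ℝ)) ^ i.k)
    (d₁ d₂ : ℕ) {δ αst α' C As Ak θE : ℝ} (hAs : 0 ≤ As) (hAk : 0 ≤ Ak) (hθE : 0 ≤ θE) (hC : 0 ≤ C)
    (hαδ : 0 ≤ αst * δ) (hα'0 : 0 ≤ α') (hα'1 : α' ≤ 1) (hδ' : 0 ≤ (1 - αst) * δ)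
    (hαδ₂ : 0 ≤ αst * ((1 - α') * ((1 - αst) * δ))) (hδ'₂ : 0 ≤ (1 - αst) * ((1 - α') * ((1 - αst) * δ)))
    (htri : Triangle254 (toB6 (geo9K i) Rr Hp)) (hdnn : ∀ a a' : (geo9K i).Site, 0 ≤ (geo9K i).dist a a')
    (hST : ScaleTransfer (geo9K i) δ αst C (fun a => (geo9K i).len a ^ 2))
    (h261 : Ineq261 d₁ (toB6 (geo9K i) Rr Hp) ((1 - αst) * δ) α')
    (hST₂ : ScaleTransfer (geo9K i) ((1 - α') * ((1 - αst) * δ)) αst C (fun a => (geo9K i).len a ^ 2))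
    (h261₂ : Ineq261 d₂ (toB6 (geo9K i) Rr Hp) ((1 - αst) * ((1 - α') * ((1 - αst) * δ))) α')
    (hE : HasMajorant (g := toB6 (geo9K i) Rr Hp) (fun p : SiteY i × ι => ιB (blkOf i.D.toDomains p.1))
      (conj b ((etaS i ^ 2)⁻¹ • (deltaPrimeAY i (parSymY i) U - deltaPrimeAY i (parKnitY i) U).restrictScalars ℝ))
      (fun a a' : (geo9K i).Site => if a = a' then θE else 0))
    (hGs : HasMajorant (g := toB6 (geo9K i) Rr Hp) (fun p : SiteY i × ι => ιB (blkOf i.D.toDomains p.1))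
      (conj b ((etaS i ^ 2) • (GpY i (parSymY i) U).restrictScalars ℝ)) (fun a a' => As * (geo9K i).len a ^ 2 * Real.exp (-(δ * (geo9K i).dist a a'))))
    (hGk : HasMajorant (g := toB6 (geo9K i) Rr Hp) (fun p : SiteY i × ι => ιB (blkOf i.D.toDomains p.1))
      (conj b ((etaS i ^ 2) • (GpY i (parKnitY i) U).restrictScalars ℝ)) (fun a a' => Ak * (geo9K i).len a ^ 2 * Real.exp (-(δ * (geo9K i).dist a a')))) :
    HasMajorant (g := toB6 (geo9K i) Rr Hp) (fun p : SiteY i × ι => ιB (blkOf i.D.toDomains p.1))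
      (conj b ((etaS i ^ 2 * etaS i ^ 2) • ((GpY i (parSymY i) U).restrictScalars ℝ * (GpY i (parSymY i) U).restrictScalars ℝ -
        (GpY i (parKnitY i) U).restrictScalars ℝ * (GpY i (parKnitY i) U).restrictScalars ℝ)))
      (fun a a' => (As + Ak) * (Ak * (θE * As) * C * B6.c1 d₁ ((1 - αst) * δ) α') * C * B6.c1 d₂ ((1 - αst) * ((1 - α') * ((1 - αst) * δ))) α' *
        ((geo9K i).len a ^ 2 * (geo9K i).len a ^ 2) *
        Real.exp (-((1 - α') * ((1 - αst) * ((1 - α') * ((1 - αst) * δ))) * (geo9K i).dist a a'))) := by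
  set Gs : Module.End ℝ (SiteY i → Matrix (Fin N) (Fin N) ℂ) := (GpY i (parSymY i) U).restrictScalars ℝ with hGs_def
  set Gk : Module.End ℝ (SiteY i → Matrix (Fin N) (Fin N) ℂ) := (GpY i (parKnitY i) U).restrictScalars ℝ with hGk_def
  set δ' : ℝ := (1 - α') * ((1 - αst) * δ) with hδ'def
  set θD : ℝ := Ak * (θE * As) * C * B6.c1 d₁ ((1 - αst) * δ) α' with hθDdef
  have hl : ∀ a : (geo9K i).Site, 0 ≤ (geo9K i).len a ^ 2 := fun a => sq_nonneg _
  have hθD : 0 ≤ θD := mul_nonneg (mul_nonneg (mul_nonneg hAk (mul_nonneg hθE hAs)) hC) (c1_nonneg _ _ _)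
  have hle : δ' ≤ δ := rate_le hαδ hα'0 hδ'
  -- §1: the difference letter at rate `δ′`, weight `ℓ²`
  have hD := hasMajorant_conj_GpDiff i b ιB (Rr := Rr) (Hp := Hp) hG hU hparK hcf d₁ hAs hAk hθE hC hαδ hα'0 hα'1 hδ' htri hdnn hST h261 hE hGs hGk
  -- the two (3.42)₁ majorants at the rate `δ′`
  have hGs' := hasMajorant_rate_mono i (Rr := Rr) (Hp := Hp) (fun p : SiteY i × ι => ιB (blkOf i.D.toDomains p.1)) (fun a => (geo9K i).len a ^ 2) hAs hl hle hGs
  have hGk' := hasMajorant_rate_mono i (Rr := Rr) (Hp := Hp) (fun p : SiteY i × ι => ιB (blkOf i.D.toDomains p.1)) (fun a => (geo9K i).len a ^ 2) hAk hl hle hGk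
  -- the two products `a·(c − a)` and `(c − a)·c` at the second rate level
  have h1 := B9Thm39CinvUpperL.hasMajorant_conj_mul_weighted b (g := geo9K i) (R := Rr) (H := Hp) (fun p : SiteY i × ι => ιB (blkOf i.D.toDomains p.1)) d₂
    (fun a => (geo9K i).len a ^ 2) (fun a => (geo9K i).len a ^ 2) (etaS i ^ 2) (etaS i ^ 2) hAs hθD hC hl hl hαδ₂ hα'0 hα'1 hδ'₂ htri hdnn hST₂ h261₂
    hGs' hD
  have h2 := B9Thm39CinvUpperL.hasMajorant_conj_mul_weighted b (g := geo9K i) (R := Rr) (H := Hp) (fun p : SiteY i × ι => ιB (blkOf i.D.toDomains p.1)) d₂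
    (fun a => (geo9K i).len a ^ 2) (fun a => (geo9K i).len a ^ 2) (etaS i ^ 2) (etaS i ^ 2) hθD hAk hC hl hl hαδ₂ hα'0 hα'1 hδ'₂ htri hdnn hST₂ h261₂
    hD hGk'
  -- the identity `η⁴(a² − c²) = −(η⁴·a(c−a) + η⁴·(c−a)c)` under `conj`
  have hop : conj b ((etaS i ^ 2 * etaS i ^ 2) • (Gs * Gs - Gk * Gk)) =
      -(conj b ((etaS i ^ 2 * etaS i ^ 2) • (Gs * (Gk - Gs))) + conj b ((etaS i ^ 2 * etaS i ^ 2) • ((Gk - Gs) * Gk))) := by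
    rw [sq_sub_sq_eq, smul_neg, conj_neg, smul_add, conj_add]
  rw [hop]
  refine hasMajorant_mono _ (hasMajorant_neg _ (hasMajorant_add _ h1 h2)) fun a a' => le_of_eq ?_
  simp only [hθDdef, hδ'def]
  ring

/-! ## §3 ★★★ The letter `η⁴(X_sym − X_knit)` on the block carrier -/

omit [Fintype ι] [Fintype (geo9K i).Site] [DecidableEq (geo9K i).Site] in
/-- the three-term identity for `Q_s∘A∘P_s − Q_k∘C∘P_k` (linear maps between two spaces):
`= (Q_s − Q_k)∘A∘P_s + Q_k∘(A − C)∘P_s + Q_k∘C∘(P_s − P_k)`. [cite: Balaban1984PropagatorsII, (2.50) p.232, bookkeeping] -/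
theorem three_term_eq {V W : Type*} [AddCommGroup V] [Module ℝ V] [AddCommGroup W] [Module ℝ W]
    (Qs Qk : V →ₗ[ℝ] W) (Ps Pk : W →ₗ[ℝ] V) (A C : Module.End ℝ V) :
    Qs ∘ₗ A ∘ₗ Ps - Qk ∘ₗ C ∘ₗ Pk = (Qs - Qk) ∘ₗ A ∘ₗ Ps + Qk ∘ₗ (A - C) ∘ₗ Ps + Qk ∘ₗ C ∘ₗ (Ps - Pk) := by
  simp only [LinearMap.sub_comp, LinearMap.comp_sub]
  abel

omit [Fintype ι] [Fintype (geo9K i).Site] [DecidableEq (geo9K i).Site] in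
/-- `η⁴·(X(U; par₁) − X(U; par₂))` restricted to real scalars as the three-term word of §3 (`X = Q′∘G′∘G′∘Q′*`, def-Y's `XY`; the scale moved to the middle).
[cite: Balaban1985BackgroundPropagators, (3.25) p.395, dictionary] -/
theorem smul_XY_sub_eq {𝔸 : Type} [NormedRing 𝔸] [NormedAlgebra ℂ 𝔸] [CompleteSpace 𝔸] (par₁ par₂ : SiteParY 𝔸 i) (Gp₁ Gp₂ : SiteOpY 𝔸 i) (U : CfgY 𝔸 i) (s : ℝ) :
    s • ((XY i par₁ Gp₁ U).restrictScalars ℝ - (XY i par₂ Gp₂ U).restrictScalars ℝ) =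
      ((QpY i par₁ U).restrictScalars ℝ - (QpY i par₂ U).restrictScalars ℝ) ∘ₗ (s • ((Gp₁ U).restrictScalars ℝ * (Gp₁ U).restrictScalars ℝ)) ∘ₗ
          (QpsY i par₁ U).restrictScalars ℝ +
        (QpY i par₂ U).restrictScalars ℝ ∘ₗ (s • ((Gp₁ U).restrictScalars ℝ * (Gp₁ U).restrictScalars ℝ) - s • ((Gp₂ U).restrictScalars ℝ * (Gp₂ U).restrictScalars ℝ)) ∘ₗ
          (QpsY i par₁ U).restrictScalars ℝ +
        (QpY i par₂ U).restrictScalars ℝ ∘ₗ (s • ((Gp₂ U).restrictScalars ℝ * (Gp₂ U).restrictScalars ℝ)) ∘ₗ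
          ((QpsY i par₁ U).restrictScalars ℝ - (QpsY i par₂ U).restrictScalars ℝ) := by
  rw [smul_sub, smul_XY_restrictScalars, smul_XY_restrictScalars]
  exact three_term_eq _ _ _ _ _ _

/-- ★★★ **`η⁴·(X(U; parSymY) − X(U; parKnitY)) ≺ θ_F·ℓ(a)⁴·e^{−δ″d}` ON def-Y's BLOCK CARRIER**, `X = Q′G′²Q′*`, for `G ≤ U(N)` averaging-closed, `N ≥ 1`, a `G`-valued
`U` on [B7]'s class (52) (`pdev (liftCfg U) < α₀′(L^k)⁻²`, `0 < α₀′`, `C₀α₀′ ≤ ⅓`, `2α₀′ ≤ c₂′`), print's units `c_f = L^k`, a real basis `b` with coordinate bound `M₂`, the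
geometry at two rate levels, the diagonal majorant `θ_E·𝟙` of `η⁻²(Δ′_sym − Δ′_knit)` (file 9 §1) and the (3.42)₁ majorants `A_s·ℓ²·e^{−δd}`, `A_k·ℓ²·e^{−δd}` of `η²G′`
at the two letters: with `κ = M₂Σ_j‖b_j‖`, `κ_Δ = 2·8(d+1)²α₀′·κ`, `c₁ = c₁(d₁,(1−α_st)δ,α′)`, `c₁′ = c₁(d₂,(1−α_st)δ′,α′)`, `θ_D = A_kθ_EA_sL²c₁`,
`θ_F := κ_Δκ·A_s²L²c₁ + κκ·(A_s+A_k)θ_DL²c₁′ + κκ_Δ·A_k²L²c₁` (`L² = C`, the scale-transfer constant) and `δ″ = (1−α′)(1−α_st)(1−α′)(1−α_st)δ`: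
`conj b(η⁴·(X_s − X_k)) ≺ θ_F·ℓ(a)⁴·e^{−δ″d(a,a′)}` on `(s, j) ↦ ιB s`.
[cite: Balaban1985BackgroundPropagators, (3.25) p.395, (3.95) p.411, Thm 3.1 (3.42) p.397, (3.19) p.393, (3.21)∕(3.24) p.394; Balaban1984PropagatorsII, (2.83) p.237, (2.50)–(2.52) p.232, (2.60)–(2.61) p.234; Balaban1985Averaging, (52)–(53) pp.26–27] -/
theorem hasMajorant_conj_XY_sym_sub_knit [Nonempty (Fin N)] (hG : G ≤ unitaryUnits (Matrix (Fin N) (Fin N) ℂ)) (hGa : AvgClosed (d + 1) (ℓ + 1) G)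
    {U : CfgY (Matrix (Fin N) (Fin N) ℂ) i} (hU : ∀ μ x, U μ x ∈ G) {α₀' : ℝ} (hα : 0 < α₀') (hα3 : C0 (d + 1) * α₀' ≤ 1 / 3)
    (hα2 : 2 * α₀' ≤ c2' (d + 1) (ℓ + 1)) (h52 : pdev (liftCfg U) < α₀' * ((((ℓ + 1 : ℕ) : ℝ) ^ i.k)⁻¹) ^ 2)
    (hcf : i.cf = (((ℓ + 1 : ℕ) : ℝ)) ^ i.k)
    {M₂ : ℝ} (hM₂ : 0 ≤ M₂) (hrepr : ∀ (v : Matrix (Fin N) (Fin N) ℂ) (j : ι), |b.repr v j| ≤ M₂ * ‖v‖)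
    (d₁ d₂ : ℕ) {δ αst α' C As Ak θE : ℝ} (hAs : 0 ≤ As) (hAk : 0 ≤ Ak) (hθE : 0 ≤ θE) (hC : 0 ≤ C)
    (hαδ : 0 ≤ αst * δ) (hα'0 : 0 ≤ α') (hα'1 : α' ≤ 1) (hδ' : 0 ≤ (1 - αst) * δ)
    (hαδ₂ : 0 ≤ αst * ((1 - α') * ((1 - αst) * δ))) (hδ'₂ : 0 ≤ (1 - αst) * ((1 - α') * ((1 - αst) * δ)))
    (htri : Triangle254 (toB6 (geo9K i) Rr Hp)) (hdnn : ∀ a a' : (geo9K i).Site, 0 ≤ (geo9K i).dist a a')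
    (hST : ScaleTransfer (geo9K i) δ αst C (fun a => (geo9K i).len a ^ 2))
    (h261 : Ineq261 d₁ (toB6 (geo9K i) Rr Hp) ((1 - αst) * δ) α')
    (hST₂ : ScaleTransfer (geo9K i) ((1 - α') * ((1 - αst) * δ)) αst C (fun a => (geo9K i).len a ^ 2))
    (h261₂ : Ineq261 d₂ (toB6 (geo9K i) Rr Hp) ((1 - αst) * ((1 - α') * ((1 - αst) * δ))) α')
    (hE : HasMajorant (g := toB6 (geo9K i) Rr Hp) (fun p : SiteY i × ι => ιB (blkOf i.D.toDomains p.1))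
      (conj b ((etaS i ^ 2)⁻¹ • (deltaPrimeAY i (parSymY i) U - deltaPrimeAY i (parKnitY i) U).restrictScalars ℝ))
      (fun a a' : (geo9K i).Site => if a = a' then θE else 0))
    (hGs : HasMajorant (g := toB6 (geo9K i) Rr Hp) (fun p : SiteY i × ι => ιB (blkOf i.D.toDomains p.1))
      (conj b ((etaS i ^ 2) • (GpY i (parSymY i) U).restrictScalars ℝ)) (fun a a' => As * (geo9K i).len a ^ 2 * Real.exp (-(δ * (geo9K i).dist a a'))))
    (hGk : HasMajorant (g := toB6 (geo9K i) Rr Hp) (fun p : SiteY i × ι => ιB (blkOf i.D.toDomains p.1))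
      (conj b ((etaS i ^ 2) • (GpY i (parKnitY i) U).restrictScalars ℝ)) (fun a a' => Ak * (geo9K i).len a ^ 2 * Real.exp (-(δ * (geo9K i).dist a a')))) :
    HasMajorant (g := toB6 (geo9K i) Rr Hp) (fun q : BlkY i × ι => ιB q.1)
      (conj b ((etaS i ^ 2 * etaS i ^ 2) • ((XY i (parSymY i) (GpY i (parSymY i)) U).restrictScalars ℝ -
        (XY i (parKnitY i) (GpY i (parKnitY i)) U).restrictScalars ℝ)))
      (fun a a' =>
        ((2 * (8 * ((d : ℝ) + 1) ^ 2 * α₀') * (M₂ * ∑ j, ‖b j‖)) * (M₂ * ∑ j, ‖b j‖) * (As * As * C * B6.c1 d₁ ((1 - αst) * δ) α') +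
          (M₂ * ∑ j, ‖b j‖) * (M₂ * ∑ j, ‖b j‖) *
            ((As + Ak) * (Ak * (θE * As) * C * B6.c1 d₁ ((1 - αst) * δ) α') * C * B6.c1 d₂ ((1 - αst) * ((1 - α') * ((1 - αst) * δ))) α') +
          (M₂ * ∑ j, ‖b j‖) * ((2 * (8 * ((d : ℝ) + 1) ^ 2 * α₀') * (M₂ * ∑ j, ‖b j‖))) * (Ak * Ak * C * B6.c1 d₁ ((1 - αst) * δ) α')) *
        (geo9K i).len a ^ 4 *
        Real.exp (-((1 - α') * ((1 - αst) * ((1 - α') * ((1 - αst) * δ))) * (geo9K i).dist a a'))) := by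
  have hparK : ∀ z w : SiteY i, parKnitY i U z w ∈ G := fun z w => parKnitY_mem_of_pdev i hGa hU hα hα3 hα2 h52 z w
  have hparS : ∀ z w : SiteY i, ‖(parSymY i U z w : Matrix (Fin N) (Fin N) ℂ)‖ ≤ 1 ∧
      ‖(((parSymY i U z w)⁻¹ : (Matrix (Fin N) (Fin N) ℂ)ˣ) : Matrix (Fin N) (Fin N) ℂ)‖ ≤ 1 := fun z w => by
    letI : CStarAlgebra (Matrix (Fin N) (Fin N) ℂ) := {}
    exact B7Prop1Explicit.mem_U1.1 (B7Prop2Explicit.unitaryUnits_le_U1 (hG (parSymY_mem i hU z w)))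
  have hparKc : ∀ z w : SiteY i, ‖(parKnitY i U z w : Matrix (Fin N) (Fin N) ℂ)‖ ≤ 1 ∧
      ‖(((parKnitY i U z w)⁻¹ : (Matrix (Fin N) (Fin N) ℂ)ˣ) : Matrix (Fin N) (Fin N) ℂ)‖ ≤ 1 := fun z w => by
    letI : CStarAlgebra (Matrix (Fin N) (Fin N) ℂ) := {}
    exact B7Prop1Explicit.mem_U1.1 (B7Prop2Explicit.unitaryUnits_le_U1 (hG (hparK z w)))
  -- the three-term identity
  rw [smul_XY_sub_eq]
  set Gs : Module.End ℝ (SiteY i → Matrix (Fin N) (Fin N) ℂ) := (GpY i (parSymY i) U).restrictScalars ℝ with hGs_def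
  set Gk : Module.End ℝ (SiteY i → Matrix (Fin N) (Fin N) ℂ) := (GpY i (parKnitY i) U).restrictScalars ℝ with hGk_def
  set δ' : ℝ := (1 - α') * ((1 - αst) * δ) with hδ'def
  set δ'' : ℝ := (1 - α') * ((1 - αst) * δ') with hδ''def
  set κ : ℝ := M₂ * ∑ j, ‖b j‖ with hκdef
  set κΔ : ℝ := 2 * (8 * ((d : ℝ) + 1) ^ 2 * α₀') * (M₂ * ∑ j, ‖b j‖) with hκΔdef
  set K₁ : ℝ := As * As * C * B6.c1 d₁ ((1 - αst) * δ) α' with hK₁def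
  set K₂ : ℝ := (As + Ak) * (Ak * (θE * As) * C * B6.c1 d₁ ((1 - αst) * δ) α') * C * B6.c1 d₂ ((1 - αst) * δ') α' with hK₂def
  set K₃ : ℝ := Ak * Ak * C * B6.c1 d₁ ((1 - αst) * δ) α' with hK₃def
  have hSb : 0 ≤ ∑ j, ‖b j‖ := Finset.sum_nonneg fun _ _ => norm_nonneg _
  have hκ : 0 ≤ κ := mul_nonneg hM₂ hSb
  have hκΔ : 0 ≤ κΔ := by positivity
  have hc₁ := c1_nonneg d₁ ((1 - αst) * δ) α'
  have hc₂ := c1_nonneg d₂ ((1 - αst) * δ') α'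
  have hK₁ : 0 ≤ K₁ := by positivity
  have hK₂ : 0 ≤ K₂ := by positivity
  have hK₃ : 0 ≤ K₃ := by positivity
  have hl4 : ∀ a : (geo9K i).Site, 0 ≤ (geo9K i).len a ^ 2 * (geo9K i).len a ^ 2 := fun a => mul_nonneg (sq_nonneg _) (sq_nonneg _)
  have hle' : δ'' ≤ δ' := rate_le hαδ₂ hα'0 hδ'₂
  -- the three middle letters at the rate `δ″`
  have hT₁ : HasMajorant (g := toB6 (geo9K i) Rr Hp) (fun p : SiteY i × ι => ιB (blkOf i.D.toDomains p.1))
      (conj b ((etaS i ^ 2 * etaS i ^ 2) • (Gs * Gs))) (fun a a' => K₁ * ((geo9K i).len a ^ 2 * (geo9K i).len a ^ 2) * Real.exp (-(δ'' * (geo9K i).dist a a'))) :=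
    hasMajorant_rate_mono i (Rr := Rr) (Hp := Hp) _ (fun a => (geo9K i).len a ^ 2 * (geo9K i).len a ^ 2) hK₁ hl4 hle'
      (hasMajorant_conj_sq i b ιB Gs d₁ hAs hC hαδ hα'0 hα'1 hδ' htri hdnn hST h261 hGs)
  have hT₃ : HasMajorant (g := toB6 (geo9K i) Rr Hp) (fun p : SiteY i × ι => ιB (blkOf i.D.toDomains p.1))
      (conj b ((etaS i ^ 2 * etaS i ^ 2) • (Gk * Gk))) (fun a a' => K₃ * ((geo9K i).len a ^ 2 * (geo9K i).len a ^ 2) * Real.exp (-(δ'' * (geo9K i).dist a a'))) :=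
    hasMajorant_rate_mono i (Rr := Rr) (Hp := Hp) _ (fun a => (geo9K i).len a ^ 2 * (geo9K i).len a ^ 2) hK₃ hl4 hle'
      (hasMajorant_conj_sq i b ιB Gk d₁ hAk hC hαδ hα'0 hα'1 hδ' htri hdnn hST h261 hGk)
  have hT₂ : HasMajorant (g := toB6 (geo9K i) Rr Hp) (fun p : SiteY i × ι => ιB (blkOf i.D.toDomains p.1))
      (conj b ((etaS i ^ 2 * etaS i ^ 2) • (Gs * Gs) - (etaS i ^ 2 * etaS i ^ 2) • (Gk * Gk)))
      (fun a a' => K₂ * ((geo9K i).len a ^ 2 * (geo9K i).len a ^ 2) * Real.exp (-(δ'' * (geo9K i).dist a a'))) := by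
    have h := hasMajorant_conj_sqDiff i b ιB (Rr := Rr) (Hp := Hp) hG hU hparK hcf d₁ d₂ hAs hAk hθE hC hαδ hα'0 hα'1 hδ' hαδ₂ hδ'₂ htri hdnn hST h261
      hST₂ h261₂ hE hGs hGk
    rw [smul_sub] at h
    exact h
  -- nonnegativity of the three middle kernels
  have hk₁ : ∀ a a' : (geo9K i).Site, 0 ≤ K₁ * ((geo9K i).len a ^ 2 * (geo9K i).len a ^ 2) * Real.exp (-(δ'' * (geo9K i).dist a a')) := fun a a' =>
    mul_nonneg (mul_nonneg hK₁ (hl4 a)) (Real.exp_nonneg _)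
  have hk₂ : ∀ a a' : (geo9K i).Site, 0 ≤ K₂ * ((geo9K i).len a ^ 2 * (geo9K i).len a ^ 2) * Real.exp (-(δ'' * (geo9K i).dist a a')) := fun a a' =>
    mul_nonneg (mul_nonneg hK₂ (hl4 a)) (Real.exp_nonneg _)
  have hk₃ : ∀ a a' : (geo9K i).Site, 0 ≤ K₃ * ((geo9K i).len a ^ 2 * (geo9K i).len a ^ 2) * Real.exp (-(δ'' * (geo9K i).dist a a')) := fun a a' =>
    mul_nonneg (mul_nonneg hK₃ (hl4 a)) (Real.exp_nonneg _)
  -- the three sandwiches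
  have hS₁ := hasMajorant_conj_sandwich i b ιB (Rr := Rr) (Hp := Hp) hκ hk₁
    (hasMajorantHom_conjHom_QpY_sym_sub_knit i b ιB hG hGa hU hα hα3 hα2 h52 hM₂ hrepr)
    (hasMajorantHom_conjHom_QpsY i b ιB (parSymY i) U hparS hM₂ hrepr) hT₁
  have hS₂ := hasMajorant_conj_sandwich i b ιB (Rr := Rr) (Hp := Hp) hκ hk₂
    (hasMajorantHom_conjHom_QpY i b ιB (parKnitY i) U hparKc hM₂ hrepr)
    (hasMajorantHom_conjHom_QpsY i b ιB (parSymY i) U hparS hM₂ hrepr) hT₂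
  have hS₃ := hasMajorant_conj_sandwich i b ιB (Rr := Rr) (Hp := Hp) hκΔ hk₃
    (hasMajorantHom_conjHom_QpY i b ιB (parKnitY i) U hparKc hM₂ hrepr)
    (hasMajorantHom_conjHom_QpsY_sym_sub_knit i b ιB hG hGa hU hα hα3 hα2 h52 hM₂ hrepr) hT₃
  -- the sum of the three sandwiches
  rw [conj_add, conj_add]
  refine hasMajorant_mono _ (hasMajorant_add _ (hasMajorant_add _ hS₁ hS₂) hS₃) fun a a' => le_of_eq ?_
  have h4 : (geo9K i).len a ^ 2 * (geo9K i).len a ^ 2 = (geo9K i).len a ^ 4 := by ring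
  simp only [hκdef, hκΔdef, hK₁def, hK₂def, hK₃def, hδ''def, hδ'def, h4]
  ring

end Literature.MathematicalPhysics.QuantumFieldTheory.Balaban1983to89.B9B8KnitLetterXDiffMajorant

end
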